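import Summits.BirchSwinnertonDyer.Rank1Residual.O5.FlexNFCaseNKodairaCellsThree
import Summits.BirchSwinnertonDyer.Rank1Residual.O5.FlexNFCaseNTailThree
import HarnessLib

/-!
# O5 — T29.6 in normal form `FlexNFTypeIIIFlatUnitThree` PROVED AS TYPED (`_holds`)

HONEST FRAMING (cell `b2b-bsdres`, verbatim): research route; the goal of the lane is to DELETE the
COMBINATION-SHAPED residual classes for ALL analytic-rank `≤ 1` curves over `ℚ` — "full BSD formula for every
rank `≤ 1` curve in class `C`" assembled STRICTLY from published theorems — so that the rank-`≤ 1` remainder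
becomes exactly the CONSTRUCTION-SHAPED classes, which are TYPED, not attempted; this is not "finishing BSD".
This file proves ONE `@[conjecture]`-tagged THEOREM-CANDIDATE node of `O5/O5FlatKummerNormalForm.lean`
(o5-r1 GEN 13 T29.6 / cc-typer-5 A-O5-28) EXACTLY AS TYPED; theorems only — nothing of the typer's file is
edited (the tag's retirement is the typer's edit), nothing is booked, no mark / label / count of
`RESIDUAL-MAP.md` moves, NO Literature fact is minted, O5 stays OPEN.  (n1011-p18 lineage, GEN 14.)

## What is proved
`FlexNormalForm.flexNFTypeIIIFlatUnitThree_holds : FlexNFTypeIIIFlatUnitThree`: for `b, A₃ ∈ ℤ` with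
`A₃ ≡ 1 (mod 3)`, `b³ ≠ A₃`, if `y² + 3b·xy + A₃y = x³` has Kodaira type `III` at `3` then its `φ̂`-Kummer
image is FLAT and contains a UNIT class (`NFKummerFlat b A₃ 0 ∧ NFKummerHasUnit b A₃ 0`).

## Why the node's own reduction no longer applies, and the proof
The typer's bookkeeping `typeIII_flatUnit_of_laws : FlexNFCaseNKodairaLawThree → FlexNFCaseNKummerLawThree → …`
cannot be instantiated: the Kodaira node T30.4 `FlexNFCaseNKodairaLawThree` is FALSE AS TYPED
(`not_flexNFCaseNKodairaLawThree`, `O5/FlexNFCaseNTailThree.lean`, fuel artefact `ord3 64`).  T29.6 itself is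
unaffected: by `nfKummer_flatUnit_of_emod_nine` (typer appendix §T) the conclusion holds whenever `A₃ ≢ 1 (mod 9)`,
so it suffices that **type `III` forces `A₃ ≢ 1 (mod 9)`** (`emod_nine_ne_one_of_kodairaSymbolAt_eq_III`).  With the
TRUE valuation `w = v₃(b³ − A₃)` the Case-N cells with `A₃ ≡ 1 (mod 9)` are: `b ≢ 1 (mod 3)` ⇒ type `II`
(`kodairaSymbolAt_and_ord_nfQ_zero_II`: `9 ∤ A₃ − 3b + 2`, `3 ∤ b³ − A₃`); `b ≡ 1 (mod 3)` ⇒ `9 ∣ b³ − A₃` and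
`w = 2` ⇒ `IV`, `w = 3` ⇒ `I₀*` (`…_IV`, `…_Istar_zero`), `w ≥ 4` ⇒ `I*_{w−3}` (`kodairaSymbolAt_and_ord_nfQ_zero_tail`)
— none of them `III`.
-/

namespace Summit.BirchSwinnertonDyer.Rank1Residual.O5.FlexNormalForm

open Summit.BirchSwinnertonDyer.Rank1Residual Literature.NumberTheory.DiophantineGeometry

/-- `3ʷ ∥ x` for `w = v₃(x)`, `x ≠ 0` (Mathlib's `padicValInt`). [folklore] -/
private theorem pow_padicValInt_dvd_and_not (x : ℤ) (hx : x ≠ 0) :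
    (3 : ℤ) ^ padicValInt 3 x ∣ x ∧ ¬ (3 : ℤ) ^ (padicValInt 3 x + 1) ∣ x := by
  haveI : Fact (Nat.Prime 3) := ⟨Nat.prime_three⟩
  refine ⟨by exact_mod_cast padicValInt_dvd (p := 3) x, fun h ↦ ?_⟩
  rcases (padicValInt_dvd_iff (p := 3) (padicValInt 3 x + 1) x).1 (by exact_mod_cast h) with h0 | hle
  · exact hx h0
  · omega

/-- **Type `III` never occurs on a Case-N cell with `A₃ ≡ 1 (mod 9)`**: there the Kodaira type at `3` of
`y² + 3b·xy + A₃y = x³` is `II` (`b ≢ 1 (mod 3)`), `IV` (`9 ∥ b³ − A₃`), `I₀*` (`27 ∥ b³ − A₃`) or `Iₙ*`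
(`3ʷ ∥ b³ − A₃`, `w ≥ 4`, `n = w − 3`) — Tate's algorithm in the kernel, cells of `FlexNFCaseNKodairaCellsThree`
and the tail of `FlexNFCaseNTailThree`. [cite: SilvermanATAEC1994, IV.9.4 (Tate's algorithm)] -/
theorem kodairaSymbolAt_ne_III_of_emod_nine_eq_one (b A₃ : ℤ) (hA : A₃ % 3 = 1) (hΔ : b ^ 3 ≠ A₃)
    (h₉ : A₃ % 9 = 1) : (nfQ b A₃ 0).kodairaSymbolAt (Additive.placeOf 3) ≠ .III := by
  by_cases hb : b % 3 = 1
  · -- `b ≡ 1 (mod 3)`: `9 ∣ b³ − A₃`; split by the true valuation `w = v₃(b³ − A₃) ≥ 2`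
    have hx : b ^ 3 - A₃ ≠ 0 := sub_ne_zero.2 hΔ
    obtain ⟨hM, hM'⟩ := pow_padicValInt_dvd_and_not (b ^ 3 - A₃) hx
    set w := padicValInt 3 (b ^ 3 - A₃) with hw
    have h9 : (3 : ℤ) ^ 2 ∣ b ^ 3 - A₃ := by
      obtain ⟨k, hk⟩ : ∃ k, b = 3 * k + 1 := ⟨b / 3, by omega⟩
      obtain ⟨t, ht⟩ : ∃ t, A₃ = 9 * t + 1 := ⟨A₃ / 9, by omega⟩
      exact ⟨3 * k ^ 3 + 3 * k ^ 2 + k - t, by rw [hk, ht]; ring⟩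
    have hw2 : 2 ≤ w := by
      haveI : Fact (Nat.Prime 3) := ⟨Nat.prime_three⟩
      rcases (padicValInt_dvd_iff (p := 3) 2 (b ^ 3 - A₃)).1 (by exact_mod_cast h9) with h0 | hle
      · exact absurd h0 hx
      · exact hle
    rcases Nat.lt_or_ge w 4 with hlt | hge
    · interval_cases w
      · rw [(kodairaSymbolAt_and_ord_nfQ_zero_IV b A₃ hA hb hM hM').1]; decide
      · rw [(kodairaSymbolAt_and_ord_nfQ_zero_Istar_zero b A₃ hA hb hM hM').1]; decide
    · rw [(kodairaSymbolAt_and_ord_nfQ_zero_tail b A₃ hA hb hge hM hM').1]; exact KodairaSymbol.noConfusion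
  · -- `b ≢ 1 (mod 3)`: `9 ∤ u = A₃ − 3b + 2 ≡ 3(1 − b) (mod 9)` and `3 ∤ b³ − A₃` ⇒ type `II`
    have hu : ¬ (9 : ℤ) ∣ A₃ - 3 * b + 2 := by omega
    have hM : (3 : ℤ) ^ 0 ∣ b ^ 3 - A₃ := by rw [pow_zero]; exact one_dvd _
    have hM' : ¬ (3 : ℤ) ^ (0 + 1) ∣ b ^ 3 - A₃ := by
      rw [zero_add, pow_one]
      rintro ⟨c, hc⟩
      have hb' : b % 3 = 0 ∨ b % 3 = 2 := by omega
      rcases hb' with hb0 | hb2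
      · obtain ⟨k, hk⟩ : ∃ k, b = 3 * k := ⟨b / 3, by omega⟩
        have : A₃ = 27 * k ^ 3 - 3 * c := by rw [← hc, hk]; ring
        omega
      · obtain ⟨k, hk⟩ : ∃ k, b = 3 * k + 2 := ⟨b / 3, by omega⟩
        have : A₃ = (3 * k + 2) ^ 3 - 3 * c := by rw [← hc, hk]; ring
        have e : (3 * k + 2) ^ 3 = 3 * (9 * k ^ 3 + 18 * k ^ 2 + 12 * k + 2) + 2 := by ring
        omega
    rw [(kodairaSymbolAt_and_ord_nfQ_zero_II b A₃ hA hu (m := 0) (by norm_num) hM hM').1]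
    decide

/-- **Type `III` at `3` forces `A₃ ≢ 1 (mod 9)`** on the Case-N flex normal form (contrapositive of
`kodairaSymbolAt_ne_III_of_emod_nine_eq_one`). [cite: SilvermanATAEC1994, IV.9.4 (Tate's algorithm)] -/
theorem emod_nine_ne_one_of_kodairaSymbolAt_eq_III (b A₃ : ℤ) (hA : A₃ % 3 = 1) (hΔ : b ^ 3 ≠ A₃)
    (hIII : (nfQ b A₃ 0).kodairaSymbolAt (Additive.placeOf 3) = .III) : A₃ % 9 ≠ 1 :=
  fun h₉ ↦ kodairaSymbolAt_ne_III_of_emod_nine_eq_one b A₃ hA hΔ h₉ hIII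

/-- **T29.6 in normal form, PROVED AS TYPED: `FlexNFTypeIIIFlatUnitThree` holds.**  A Case-N flex normal form
`y² + 3b·xy + A₃y = x³` (`A₃ ≡ 1 (mod 3)`, `b³ ≠ A₃`) of Kodaira type `III` at `3` has `φ̂`-Kummer image FLAT and
containing a UNIT class: type `III` forces `A₃ ≢ 1 (mod 9)` (Tate's algorithm, above), and on every Case-N cell with
`A₃ ≢ 1 (mod 9)` the image is flat with a unit class (`nfKummer_flatUnit_of_emod_nine`: FILE V's
`ne_zero_and_three_dvd_valuation` + p308301's `exists_point_not_cube`).  The node's own reduction through T30.4 is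
void (T30.4 refuted as typed); this proof does not use T30.4.
[cite: SilvermanATAEC1994, IV.9.4 (Tate's algorithm)] [cite: DokchitserDokchitser2015LocalInvariantsIsogenous, Lemma 10 (arXiv:1208.5519 p. 7)] -/
theorem flexNFTypeIIIFlatUnitThree_holds : FlexNFTypeIIIFlatUnitThree := by
  intro b A₃ hA hΔ hIII
  exact nfKummer_flatUnit_of_emod_nine b A₃ hA (emod_nine_ne_one_of_kodairaSymbolAt_eq_III b A₃ hA hΔ hIII)

end Summit.BirchSwinnertonDyer.Rank1Residual.O5.FlexNormalForm
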